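import Literature.NumberTheory.EllipticCurves.RealLatticeCovolumeProofs
import Literature.NumberTheory.EllipticCurves.WeierstrassAdditionProofs
import HarnessLib

/-!
# The three real roots of `4x³ − g₂x − g₃` for a rectangular real lattice

Helper file for the support item `EllipticAreaIdentity` of route `MultivaluedCoV`
(`Summits/KontsevichZagierPeriods/KontsevichZagierPeriods/Theses/MultivaluedCoV.lean`).

For a real lattice `Λ` (Mathlib `PeriodPair` `L`, `L.IsReal`) with real invariants `g₂, g₃` and
`g₂³ − 27g₃² > 0`, the cubic `f(x) = 4x³ − g₂x − g₃` has the three real roots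
`e₃ < e₂ < e₁`, where `e₁ = ℘(Ω₀/2)` and `e₃ = ℘(iΩ₀'/2) = −℘_{iΛ}(Ω₀'/2)` (`Ω₀`, `Ω₀'` the least
positive real periods of `Λ`, `iΛ`) and `e₂ = −e₁ − e₃` (`roots_of_discr_pos`; Lawden, *Elliptic
Functions and Applications*, §6.11 and §6.16; the tree's `RealLatticePeriodDiscrProofs.lean`
proves the sign of `f` beyond `e₁` and below `e₃`). Consequently the domain of the route's
representation `[R, 1/√(−f(s)f(t))]`, written with the polynomial literals
`f(s) > 0 ∧ f'(s) > 0 ∧ s > 0`, `f(t) < 0 ∧ f'(t) > 0 ∧ t < 0`, is the product of rays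
`(e₁, ∞) × (−∞, e₃)` (`setOf_cubic_domain_pos`, `setOf_cubic_domain_neg`, `setOf_domain_eq`).

## References
* D. F. Lawden, *Elliptic Functions and Applications*, Springer 1989, §6.11, §6.16.
-/

noncomputable section

open scoped ComplexConjugate Topology PeriodPair
open Complex Set Filter

namespace Summit.KontsevichZagierPeriods.MultivaluedCoV.EllipticArea

/-! ### Elementary algebra of a cubic `4x³ − Ax − B` with three real roots -/

/-- A cubic `4x³ − Ax − B` with `A³ − 27B² > 0`, two roots `e₃ ≠ e₁`, positive beyond `e₁` and
negative below `e₃`, factors as `4(x − e₁)(x − e₂)(x − e₃)` with `e₂ = −e₁ − e₃` and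
`e₃ < e₂ < e₁`. -/
theorem cubic_roots_order {A B e₁ e₃ : ℝ} (hdisc : 0 < A ^ 3 - 27 * B ^ 2)
    (he₁ : 4 * e₁ ^ 3 - A * e₁ - B = 0) (he₃ : 4 * e₃ ^ 3 - A * e₃ - B = 0) (hne : e₃ ≠ e₁)
    (hpos : ∀ x, e₁ < x → 0 < 4 * x ^ 3 - A * x - B)
    (hneg : ∀ x, x < e₃ → 4 * x ^ 3 - A * x - B < 0) :
    e₃ < -e₁ - e₃ ∧ -e₁ - e₃ < e₁ ∧
      ∀ x, 4 * x ^ 3 - A * x - B = 4 * (x - e₁) * (x - (-e₁ - e₃)) * (x - e₃) := by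
  -- `e₃ < e₁`
  have h31 : e₃ < e₁ := by
    rcases lt_or_gt_of_ne hne with hlt | hlt
    · exact hlt
    · exact absurd he₃ (hpos e₃ hlt).ne'
  -- the quadratic cofactor vanishes at `e₃`
  have hq : 4 * e₃ ^ 2 + 4 * e₁ * e₃ + (4 * e₁ ^ 2 - A) = 0 := by
    have := PeriodPair.cubic_eq_mul_of_root he₁ e₃
    rw [he₃, eq_comm, mul_eq_zero] at this
    exact this.resolve_left (sub_ne_zero.mpr hne)
  have hprod : ∀ x, 4 * x ^ 3 - A * x - B = 4 * (x - e₁) * (x - (-e₁ - e₃)) * (x - e₃) := by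
    intro x
    linear_combination PeriodPair.cubic_eq_mul_of_root he₁ x + (x - e₁) * hq
  set e₂ := -e₁ - e₃ with he₂
  -- no double roots
  have h21 : e₂ ≠ e₁ := by
    intro heq
    have h12 : 12 * e₁ ^ 2 - A ≠ 0 := by
      intro h0
      rw [PeriodPair.cubic_discr_eq_of_root he₁, h0] at hdisc
      simp at hdisc
    apply h12
    have heq' : e₃ + 2 * e₁ = 0 := by rw [he₂] at heq; linarith
    linear_combination hq + (-4 * (e₃ - e₁)) * heq'
  have h23 : e₂ ≠ e₃ := by
    intro heq
    have h12 : 12 * e₃ ^ 2 - A ≠ 0 := by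
      intro h0
      rw [PeriodPair.cubic_discr_eq_of_root he₃, h0] at hdisc
      simp at hdisc
    apply h12
    have heq' : e₁ + 2 * e₃ = 0 := by rw [he₂] at heq; linarith
    linear_combination hq + (-4 * (e₁ - e₃)) * heq'
  refine ⟨?_, ?_, hprod⟩
  · by_contra hle
    push Not at hle
    rcases hle.lt_or_eq with hlt | heq
    · -- `e₂ < e₃`: test the midpoint
      set x := (e₂ + e₃) / 2 with hx
      have hx3 : x < e₃ := by rw [hx]; linarith
      have h1 : x - e₁ < 0 := by linarith
      have h2 : 0 < x - e₂ := by rw [hx]; linarith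
      have h3 : x - e₃ < 0 := by linarith
      have hfx : 0 < 4 * (x - e₁) * (x - e₂) * (x - e₃) := by
        have := mul_pos (mul_pos_of_neg_of_neg h1 h3) h2
        nlinarith
      rw [← hprod x] at hfx
      exact absurd hfx (not_lt.mpr (hneg x hx3).le)
    · exact h23 heq
  · by_contra hle
    push Not at hle
    rcases hle.lt_or_eq with hlt | heq
    · -- `e₁ < e₂`: test the midpoint
      set x := (e₁ + e₂) / 2 with hx
      have hx1 : e₁ < x := by rw [hx]; linarith
      have h1 : 0 < x - e₁ := by linarith
      have h2 : x - e₂ < 0 := by rw [hx]; linarith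
      have h3 : 0 < x - e₃ := by linarith
      have hfx : 4 * (x - e₁) * (x - e₂) * (x - e₃) < 0 := by
        have := mul_neg_of_pos_of_neg (mul_pos h1 h3) h2
        nlinarith
      rw [← hprod x] at hfx
      exact absurd hfx (not_lt.mpr (hpos x hx1).le)
    · exact h21 heq.symm

/-- For a cubic `4(x − e₁)(x − e₂)(x − e₃)` with `e₃ < e₂ < e₁`, `e₁ + e₂ + e₃ = 0`:
`{x | f(x) > 0, f'(x) = 12x² − A > 0, x > 0} = (e₁, ∞)`. -/
theorem setOf_cubic_domain_pos {A B e₁ e₂ e₃ : ℝ} (h32 : e₃ < e₂) (h21 : e₂ < e₁)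
    (hsum : e₁ + e₂ + e₃ = 0)
    (hf : ∀ x, 4 * x ^ 3 - A * x - B = 4 * (x - e₁) * (x - e₂) * (x - e₃)) :
    {x : ℝ | 0 < 4 * x ^ 3 - A * x - B ∧ 0 < 12 * x ^ 2 - A ∧ 0 < x} = Ioi e₁ := by
  have hA : A = -4 * (e₁ * e₂ + e₁ * e₃ + e₂ * e₃) := by
    linear_combination (hf (-1) - hf 1) / 2
  have he₁ : 0 < e₁ := by linarith
  ext x
  simp only [mem_setOf_eq, mem_Ioi, hf]
  constructor
  · rintro ⟨hfx, hdx, hx0⟩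
    by_contra hle
    push Not at hle
    have hne : x ≠ e₁ := by
      rintro rfl
      simp at hfx
    have hlt : x < e₁ := lt_of_le_of_ne hle hne
    have h1 : x - e₁ < 0 := by linarith
    -- `(x - e₂)(x - e₃) < 0`, so `e₃ < x < e₂`
    have h23 : (x - e₂) * (x - e₃) < 0 := by nlinarith
    have hx2 : x < e₂ := by
      by_contra h'
      push Not at h'
      have : 0 ≤ (x - e₂) * (x - e₃) := mul_nonneg (by linarith) (by linarith)
      linarith
    -- then `12 x² < 12 e₂² ≤ A`
    have he₂ : 0 < e₂ := by linarith
    have hsq : x ^ 2 < e₂ ^ 2 := by nlinarith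
    have hAe : 12 * e₂ ^ 2 ≤ A := by
      rw [hA, show e₃ = -e₁ - e₂ by linarith]
      nlinarith [mul_pos (sub_pos.mpr h21) (by linarith : 0 < e₁ + 2 * e₂)]
    linarith
  · intro hx
    have h1 : 0 < x - e₁ := by linarith
    have h2 : 0 < x - e₂ := by linarith
    have h3 : 0 < x - e₃ := by linarith
    refine ⟨by positivity, ?_, by linarith⟩
    have hsq : e₁ ^ 2 < x ^ 2 := by nlinarith
    have hAe : A < 12 * e₁ ^ 2 := by
      rw [hA, show e₃ = -e₁ - e₂ by linarith]
      nlinarith [mul_pos (sub_pos.mpr h21) (by linarith : 0 < 2 * e₁ + e₂)]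
    linarith

/-- For a cubic `4(x − e₁)(x − e₂)(x − e₃)` with `e₃ < e₂ < e₁`, `e₁ + e₂ + e₃ = 0`:
`{x | f(x) < 0, f'(x) = 12x² − A > 0, x < 0} = (−∞, e₃)` (the previous lemma for `−f(−x)`). -/
theorem setOf_cubic_domain_neg {A B e₁ e₂ e₃ : ℝ} (h32 : e₃ < e₂) (h21 : e₂ < e₁)
    (hsum : e₁ + e₂ + e₃ = 0)
    (hf : ∀ x, 4 * x ^ 3 - A * x - B = 4 * (x - e₁) * (x - e₂) * (x - e₃)) :
    {x : ℝ | 4 * x ^ 3 - A * x - B < 0 ∧ 0 < 12 * x ^ 2 - A ∧ x < 0} = Iio e₃ := by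
  have hg : ∀ y, 4 * y ^ 3 - A * y - (-B) = 4 * (y - -e₃) * (y - -e₂) * (y - -e₁) := by
    intro y
    linear_combination (-1 : ℝ) * hf (-y)
  have key := setOf_cubic_domain_pos (A := A) (B := -B) (e₁ := -e₃) (e₂ := -e₂) (e₃ := -e₁)
    (by linarith) (by linarith) (by linarith) hg
  ext x
  have hx := Set.ext_iff.mp key (-x)
  simp only [mem_setOf_eq, mem_Ioi, mem_Iio] at hx ⊢
  rw [show (4 * x ^ 3 - A * x - B < 0 ∧ 0 < 12 * x ^ 2 - A ∧ x < 0) ↔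
      (0 < 4 * (-x) ^ 3 - A * -x - -B ∧ 0 < 12 * (-x) ^ 2 - A ∧ 0 < -x) by
    constructor
    · rintro ⟨h1, h2, h3⟩; exact ⟨by linarith, by linarith, by linarith⟩
    · rintro ⟨h1, h2, h3⟩; exact ⟨by linarith, by linarith, by linarith⟩, hx]
  constructor <;> intro h <;> linarith

/-! ### The roots of the cubic of a rectangular real lattice -/

variable {L : PeriodPair}

/-- `e₃ = −℘_{iΛ}(Ω₀'/2)` is a root of `4x³ − g₂x − g₃` (the root `℘_{iΛ}(Ω₀'/2)` of the cubic
`4x³ − g₂x + g₃` of `iΛ`). -/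
theorem cubic_neg_weierstrassPRe_half_mulLeft_I (h : L.IsReal) :
    4 * (-(L.mulLeft I I_ne_zero).weierstrassPRe ((L.mulLeft I I_ne_zero).minRealPeriod / 2)) ^ 3 -
      L.g₂.re * (-(L.mulLeft I I_ne_zero).weierstrassPRe
        ((L.mulLeft I I_ne_zero).minRealPeriod / 2)) - L.g₃.re = 0 := by
  have := h.mulLeft_I.cubic_weierstrassPRe_half
  rw [PeriodPair.g₂_mulLeft_I, PeriodPair.g₃_mulLeft_I, Complex.neg_re] at this
  linear_combination (-1 : ℝ) * this

/-- For a rectangular real lattice, `e₃ = ℘(iΩ₀'/2) ≠ e₁ = ℘(Ω₀/2)`: equality would force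
`iΩ₀'/2 ± Ω₀/2 ∈ Λ` (`PeriodPair.weierstrassP_eq_weierstrassP_iff`), i.e. a rhombic lattice. -/
theorem neg_weierstrassPRe_half_mulLeft_I_ne (h : L.IsReal)
    (hrect : ((L.minRealPeriod : ℂ) + I * (L.mulLeft I I_ne_zero).minRealPeriod) / 2 ∉ L.lattice) :
    -(L.mulLeft I I_ne_zero).weierstrassPRe ((L.mulLeft I I_ne_zero).minRealPeriod / 2) ≠
      L.weierstrassPRe (L.minRealPeriod / 2) := by
  set L' := L.mulLeft I I_ne_zero with hL'
  have h' : L'.IsReal := h.mulLeft_I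
  intro heq
  set w : ℂ := I * ((L'.minRealPeriod / 2 : ℝ) : ℂ) with hw
  set v : ℂ := ((L.minRealPeriod / 2 : ℝ) : ℂ) with hv
  have hPw : ℘[L] w = ((-L'.weierstrassPRe (L'.minRealPeriod / 2) : ℝ) : ℂ) := by
    rw [hw, PeriodPair.weierstrassP_I_mul, ← hL', ← h'.ofReal_weierstrassPRe]
    push_cast
    ring
  have hPv : ℘[L] v = ((L.weierstrassPRe (L.minRealPeriod / 2) : ℝ) : ℂ) := by
    rw [hv, ← h.ofReal_weierstrassPRe]
  have hP : ℘[L] w = ℘[L] v := by rw [hPw, hPv, heq]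
  have hwΛ : w ∉ L.lattice := by
    have := h.I_mul_minRealPeriod_div_two_notMem
    rw [hw]; push_cast
    rwa [show I * (((L.mulLeft I I_ne_zero).minRealPeriod : ℂ) / 2) =
      I * ((L.mulLeft I I_ne_zero).minRealPeriod : ℂ) / 2 by ring]
  have hvΛ : v ∉ L.lattice := by
    have := h.minRealPeriod_div_two_notMem
    rw [hv]; push_cast
    exact this
  have hsum : w + v = ((L.minRealPeriod : ℂ) + I * (L.mulLeft I I_ne_zero).minRealPeriod) / 2 := by
    rw [hw, hv]; push_cast; ring
  rcases (L.weierstrassP_eq_weierstrassP_iff hwΛ hvΛ).1 hP with hadd | hsub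
  · exact hrect (hsum ▸ hadd)
  · -- `w - v ∈ Λ`; conjugate and negate: `w + v ∈ Λ`
    have h1 : conj (w - v) ∈ L.lattice := h _ hsub
    have h2 : conj (w - v) = -(w + v) := by
      rw [hw, hv, map_sub, map_mul, Complex.conj_I, Complex.conj_ofReal, Complex.conj_ofReal]
      ring
    rw [h2] at h1
    have h3 : w + v ∈ L.lattice := by simpa using neg_mem h1
    exact hrect (hsum ▸ h3)

/-- **The three roots.** For a real lattice with `g₂³ − 27g₃² > 0` (rectangular), with
`e₁ = ℘(Ω₀/2)`, `e₃ = −℘_{iΛ}(Ω₀'/2) = ℘(iΩ₀'/2)` and `e₂ = −e₁ − e₃`: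
`e₃ < e₂ < e₁` and `4x³ − g₂x − g₃ = 4(x − e₁)(x − e₂)(x − e₃)` (Lawden §6.11, §6.16). -/
theorem roots_of_discr_pos (h : L.IsReal) (hdisc : 0 < L.g₂.re ^ 3 - 27 * L.g₃.re ^ 2) :
    -(L.mulLeft I I_ne_zero).weierstrassPRe ((L.mulLeft I I_ne_zero).minRealPeriod / 2) <
        -L.weierstrassPRe (L.minRealPeriod / 2) -
          -(L.mulLeft I I_ne_zero).weierstrassPRe ((L.mulLeft I I_ne_zero).minRealPeriod / 2) ∧
      -L.weierstrassPRe (L.minRealPeriod / 2) -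
          -(L.mulLeft I I_ne_zero).weierstrassPRe ((L.mulLeft I I_ne_zero).minRealPeriod / 2) <
        L.weierstrassPRe (L.minRealPeriod / 2) ∧
      ∀ x, 4 * x ^ 3 - L.g₂.re * x - L.g₃.re =
        4 * (x - L.weierstrassPRe (L.minRealPeriod / 2)) *
          (x - (-L.weierstrassPRe (L.minRealPeriod / 2) -
            -(L.mulLeft I I_ne_zero).weierstrassPRe ((L.mulLeft I I_ne_zero).minRealPeriod / 2))) *
          (x - -(L.mulLeft I I_ne_zero).weierstrassPRe
            ((L.mulLeft I I_ne_zero).minRealPeriod / 2)) :=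
  cubic_roots_order hdisc h.cubic_weierstrassPRe_half (cubic_neg_weierstrassPRe_half_mulLeft_I h)
    (neg_weierstrassPRe_half_mulLeft_I_ne h (h.half_sum_notMem_of_discr_pos hdisc))
    (fun _ hx => h.cubic_pos_of_lt hx) (fun _ hx => h.cubic_neg_of_lt hx)

/-- **The domain of `[R, 1/√(−f(s)f(t))]` is the product of rays** `(e₁, ∞) × (−∞, e₃)`: for a
real lattice with real invariants `g₂, g₃`, `g₂³ − 27g₃² > 0`, and `f = 4x³ − g₂x − g₃`,
`{(s,t) | f(s) > 0, 12s² − g₂ > 0, s > 0, f(t) < 0, 12t² − g₂ > 0, t < 0} = {(s,t) | s > e₁, t < e₃}`. -/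
theorem setOf_domain_eq (h : L.IsReal) (hdisc : 0 < L.g₂.re ^ 3 - 27 * L.g₃.re ^ 2) :
    {z : Fin 2 → ℝ | 0 < 4 * z 0 ^ 3 - L.g₂.re * z 0 - L.g₃.re ∧ 0 < 12 * z 0 ^ 2 - L.g₂.re ∧
        0 < z 0 ∧ 4 * z 1 ^ 3 - L.g₂.re * z 1 - L.g₃.re < 0 ∧ 0 < 12 * z 1 ^ 2 - L.g₂.re ∧
        z 1 < 0} =
      {z : Fin 2 → ℝ | L.weierstrassPRe (L.minRealPeriod / 2) < z 0 ∧
        z 1 < -(L.mulLeft I I_ne_zero).weierstrassPRe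
          ((L.mulLeft I I_ne_zero).minRealPeriod / 2)} := by
  obtain ⟨h32, h21, hf⟩ := roots_of_discr_pos h hdisc
  have hpos := setOf_cubic_domain_pos h32 h21 (by ring) hf
  have hneg := setOf_cubic_domain_neg h32 h21 (by ring) hf
  ext z
  have h0 := Set.ext_iff.mp hpos (z 0)
  have h1 := Set.ext_iff.mp hneg (z 1)
  simp only [mem_setOf_eq, mem_Ioi, mem_Iio] at h0 h1 ⊢
  rw [← h0, ← h1]
  tauto

end Summit.KontsevichZagierPeriods.MultivaluedCoV.EllipticArea

end
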